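import Summits.CriticalPhenomena.PercolationContinuityZ3.Theses.PercPortalLadder
import Summits.CriticalPhenomena.PercolationContinuityZ3.Theorems.PercPortalLadderPortalLadder
import HarnessLib

/-!
# `PercPortalLadder.PortalLine` (stmt-CriticalPhenomena-6258) — SETTLED after continuity

Item `stmt-CriticalPhenomena-6258` of route `CriticalPhenomena/PercPortalLadder` (crux r2, 'S(line)'): the two critical
half-spaces of `ℤ³` glued only through the portals above ONE lattice line `{x₀ = 0, x₂ = 0}` do not percolate at
`p_c(ℤ³)`: `θ_{G_line}(v, p_c) = 0` for every vertex `v`.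

As filed, `PortalLine` is the instance `P = {y | y₂ = 0}` of the route's TARGET `PortalLadder` (stmt-6257: for EVERY
portal set `P ⊆ {x₀ = 0}`, `θ_{G_P}(v, p_c) = 0`), which the tree proves from p205010
(`PercPortalLadderPortalLadder.portalLadder_proof`, lead gen 28: deleting edges only lowers `θ` — Lyons–Peres Thm 6.47
covering inequality — and `θ_{ℤ³}(v, p_c) = θ_{ℤ³}(0, p_c) = 0`).  This file records the instance; the item's
mathematical content 'false only with the conjunct' is exactly that.  No rate / first-moment input is claimed (those are
the open crux 6259 and 0913).

builds on p205010 (kernel theorem, internal audit signed; external expert review pending) — USED (through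
`portalLadder_proof`, i.e. `CSH.percolationContinuityZ3_holds`).  RSW3 lane, prover P2 gen 32 (prover-prim-rsw3-p2-g32-0).
References: R. Lyons, Y. Peres, *Probability on Trees and Networks* (2016), Thm. 6.47 [LyonsPeres2016];
G. Kozma, N. Nitzan (2024) [KozmaNitzan2024].
-/

noncomputable section

namespace Summit.CriticalPhenomena.PercolationContinuityZ3.Theorems

namespace PortalLadderPortalLine

open Literature.Probability.Percolation Literature.Probability.LatticeModels

/-- **`PercPortalLadder.PortalLine` (stmt-CriticalPhenomena-6258), settled**: the portal set `{y | y₂ = 0}` in the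
proved target `PortalLadder` (stmt-6257, p205010). [cite: KozmaNitzan2024, Thm. 6 with Conj. 3 (p. 15)] -/
theorem portalLine_proof :
    Summit.CriticalPhenomena.PercolationContinuityZ3.Theses.PercPortalLadder.PortalLine := by
  unfold Summit.CriticalPhenomena.PercolationContinuityZ3.Theses.PercPortalLadder.PortalLine
  intro v
  exact PercPortalLadderPortalLadder.portalLadder_proof {y : Site 3 | y 2 = 0} v

end PortalLadderPortalLine

end Summit.CriticalPhenomena.PercolationContinuityZ3.Theorems

end
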